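import Summits.HubbardSuperconductivity.HubbardLadder.Bounds.CurrentOperatorTTPrime
import Literature.Probability.LatticeModels.BoxSineHarmonic
import HarnessLib

/-!
# Hubbard ladder — Bounds: the current-moment sharpening of the f-sum stiffness ceiling
# (`t–t'` Hubbard class, `T = 0`; typed AND proved)

HONEST FRAMING (cell pub-hubbard): ladder R1–R4 with certified numbers; no claim on H/H₀. This is
a bound for a MODEL CLASS (the `t–t'` Hubbard torus `hubbardTorusTT' L 1 t' U` on `(ℤ/L)²`, every
`t'`, `U`, filling), no materials claim. Companion text: `pub-hubbard/paper/bounds.tex` Thm 5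
(SHARPENING #6, "current moments"); table `pub-hubbard/pub-hubbard-bounds/BOUNDS.md` row T1e.

FILE SPLIT (tree lint: files under `Summits/…` are ≤ 400 lines): part 2 of 2 — part 1 =
`CurrentOperatorTTPrime.lean` (the current operator `curOpTT'`, the sector Rayleigh bound for
non-unit vectors and the trial inequality `fluxEnergyTT'_trial_le`); this file = the `θ → 0`
extraction and the theorem with its corollaries.

## What is proved (no `sorry`, no new axioms)

Let `H = hubbardTorusTT' L 1 t' U`, `E(θ) = fluxEnergyTT' L t' U δ θ` its flux envelope in the
sector `(N_L, S^z = 0)`, `ψ` a unit zero-flux sector ground state, `K = kinOpTT' L t'` the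
`e₁`-kinetic operator (`Re⟨ψ, K ψ⟩ = 2(K_x + t' K_d)(ψ)`) and `J = curOpTT' L t'` (this file) the
`e₁`-CURRENT operator, `Re⟨χ, J χ⟩ = 2(J_x + t' J_d)(χ)` — the paramagnetic current of the band
`ε_k = −2(cos k₁ + cos k₂) − 4t' cos k₁ cos k₂` along `e₁`. Put `φ = J ψ`,
`a = ‖Jψ‖² = ⟨ψ, J² ψ⟩` (the current fluctuation, `m₀`) and
`b = Re⟨Jψ, H Jψ⟩ − E(0) ‖Jψ‖² = ⟨ψ, J (H − E₀) J ψ⟩ = ½⟨ψ, [J, [H, J]] ψ⟩` (the first current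
moment, `m₁ ≥ 0`).

* `CurrentMomentStiffnessCeilingTT'` (`@[conjecture] def`, PROVED by `…_holds`): for `L ≥ 3` and
  every `t'`, `U`, `δ`, every real `ρ_s` with `ρ_s θ² ≤ E(θ) − E(0)` for `|θ| ≤ θ₀` satisfies, for
  EVERY `μ : ℝ`,  `ρ_s L² ≤ (K_x + t' K_d)(ψ) − 2 μ a + μ² b`.
* `OptimalCurrentMomentCeilingTT'` (`@[conjecture] def`, PROVED by `…_holds`; `μ = a/b`):
  `0 ≤ b` and `ρ_s L² ≤ (K_x + t' K_d)(ψ) − a²/b` — the Literature f-sum ceiling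
  (`stiffnessTT'_mul_sq_le_kinetic_of_isGroundStateInSector`: `ρ_s L² ≤ K_x + t' K_d`, i.e.
  Scalapino–White–Zhang 1993 §II / Paramekanti–Trivedi–Randeria 1998 eq. (3) / Hazra–Verma–Randeria
  2019 eqs. (2)–(4), which DROP the paramagnetic term `Λ_xx ≥ 0`) minus the moment bound
  `m₋₁(J) ≥ m₀(J)²/m₁(J)` on the paramagnetic term (the Bohigas–Lane–Martorell /
  Pitaevskii–Stringari sum-rule inequality), here realised WITHOUT spectral decomposition by the
  one-parameter trial states `ψ ∓ μ sin(θ/L) Jψ` at flux `±θ` and the limit `θ → 0` (no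
  hypothesis on `b`: `b ≥ 0` always, `fluxEnergyTT'_zero_mul_le_re_cur`, and at `b = 0`
  Mathlib's `a²/0 = 0` returns the f-sum ceiling).
* `KinWeightStiffnessCeilingTT'` (`@[conjecture] def`, PROVED by `…_holds`; `μ = 0`): the
  Literature ceiling again, now without its hypothesis `0 < ρ_s`.

Ingredients (all Literature, PROVED there): the uniform gauge and the Rayleigh expansion of the
twisted `t–t'` torus in a fixed vector (`fluxEnergyTT'_eq_minEnergyOn_uniform`,
`re_star_dotProduct_uniformTwistTT'_mulVec`, Watanabe 2019 §2.2), time reversal `E(−θ) = E(θ)`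
(`fluxEnergyTT'_neg`, Byers–Yang), the sector Rayleigh bound (`minEnergyOn_le_rayleigh_of_mem`);
plus Mathlib's `Real.cos_bound` / `Real.sin_bound` for the `θ → 0` limit.

References (keys of `lean/references.bib`): ScalapinoWhiteZhang1993 §II;
ParamekantiTrivediRanderia1998 eq. (3) and §IV (their variational improvements coincide with the
kinetic bound for clean systems);
HazraVermaRanderia2019 eqs. (2)–(4), App. C; Watanabe2019 §2.2.1–§2.2.3, §4.1; ByersYang1961.
The moment inequality: O. Bohigas, A. M. Lane, J. Martorell, Phys. Rep. 51 (1979) 267, §2;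
L. Pitaevskii, S. Stringari, Bose–Einstein Condensation (OUP 2003), ch. 7.
-/

noncomputable section

namespace Summit.HubbardSuperconductivity.HubbardLadder.Bounds

open Matrix Finset Real
open Literature.MathematicalPhysics.QuantumLattice
open Literature.MathematicalPhysics.QuantumFieldTheory
open Literature.Probability.LatticeModels
open scoped ComplexConjugate ComplexOrder

variable {L : ℕ} [NeZero L]

/-! ### The `θ → 0` limit: elementary trigonometric bounds -/

/-- `|sin² x − x²| ≤ x⁴/2` for `0 ≤ x ≤ 1` (`x − x³/4 ≤ sin x ≤ x`). [folklore] -/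
theorem abs_sin_sq_sub_sq_le {x : ℝ} (hx0 : 0 ≤ x) (hx1 : x ≤ 1) :
    |Real.sin x ^ 2 - x ^ 2| ≤ x ^ 4 / 2 := by
  have hsx : Real.sin x ≤ x := Real.sin_le hx0
  have hs0 : 0 ≤ Real.sin x :=
    Real.sin_nonneg_of_nonneg_of_le_pi hx0 (hx1.trans (by linarith [Real.pi_gt_three]))
  have hb := Real.sin_bound (show |x| ≤ 1 by rw [abs_of_nonneg hx0]; exact hx1)
  rw [abs_of_nonneg hx0] at hb
  have hlow : x - x ^ 3 / 6 - x ^ 5 / 100 ≤ Real.sin x := by linarith [(abs_le.1 hb).1]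
  have hx3 : x ^ 5 ≤ x ^ 3 := by nlinarith [pow_nonneg hx0 3, mul_le_one₀ hx1 hx0 hx1]
  have hx31 : x ^ 3 ≤ x := by nlinarith [mul_le_one₀ hx1 hx0 hx1]
  have hy0 : 0 ≤ x - x ^ 3 / 4 := by linarith
  have hy : x - x ^ 3 / 4 ≤ Real.sin x := by linarith
  have hsq : (x - x ^ 3 / 4) ^ 2 ≤ Real.sin x ^ 2 := pow_le_pow_left₀ hy0 hy 2
  have hup : Real.sin x ^ 2 ≤ x ^ 2 := pow_le_pow_left₀ hs0 hsx 2
  rw [abs_le]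
  constructor
  · nlinarith [sq_nonneg (x ^ 3)]
  · nlinarith [pow_nonneg hx0 4]

/-- `|(1 − cos x) − x²/2| ≤ (5/96) x⁴` for `0 ≤ x ≤ 1` (`Real.cos_bound`). [folklore] -/
theorem abs_one_sub_cos_sub_le {x : ℝ} (hx0 : 0 ≤ x) (hx1 : x ≤ 1) :
    |(1 - Real.cos x) - x ^ 2 / 2| ≤ 5 / 96 * x ^ 4 := by
  have hb := Real.cos_bound (show |x| ≤ 1 by rw [abs_of_nonneg hx0]; exact hx1)
  rw [abs_of_nonneg hx0] at hb
  rw [show (1 - Real.cos x) - x ^ 2 / 2 = -(Real.cos x - (1 - x ^ 2 / 2)) by ring, abs_neg]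
  linarith

/-- If `ε ≤ C x²` for all `x ∈ (0, x₁]` with `ε > 0`, `C ≥ 0`: contradiction (take `x` small).
[folklore] -/
theorem false_of_forall_le_mul_sq {ε C x₁ : ℝ} (hε : 0 < ε) (hC : 0 ≤ C) (hx₁ : 0 < x₁)
    (h : ∀ x : ℝ, 0 < x → x ≤ x₁ → ε ≤ C * x ^ 2) : False := by
  set x₂ : ℝ := min x₁ 1 with hx₂
  have hx₂0 : 0 < x₂ := lt_min hx₁ one_pos
  have hx₂1 : x₂ ≤ 1 := min_le_right _ _
  set τ : ℝ := min 1 (ε / (2 * (C + 1))) with hτ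
  have hτ0 : 0 < τ := lt_min one_pos (div_pos hε (by positivity))
  have hτ1 : τ ≤ 1 := min_le_left _ _
  have hτε : τ ≤ ε / (2 * (C + 1)) := min_le_right _ _
  have hx : ε ≤ C * (x₂ * τ) ^ 2 :=
    h (x₂ * τ) (mul_pos hx₂0 hτ0) ((mul_le_of_le_one_right hx₂0.le hτ1).trans (min_le_left _ _))
  have h3 : C * (x₂ * τ) ^ 2 ≤ C * τ := by
    have hxτ : x₂ * τ ≤ τ := mul_le_of_le_one_left hτ0.le hx₂1
    have hxt : (x₂ * τ) ^ 2 ≤ τ :=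
      calc (x₂ * τ) ^ 2 = (x₂ * τ) * (x₂ * τ) := sq _
        _ ≤ τ * (x₂ * τ) := mul_le_mul_of_nonneg_right hxτ (mul_pos hx₂0 hτ0).le
        _ ≤ τ * τ := mul_le_mul_of_nonneg_left hxτ hτ0.le
        _ ≤ τ * 1 := mul_le_mul_of_nonneg_left hτ1 hτ0.le
        _ = τ := mul_one τ
    exact mul_le_mul_of_nonneg_left hxt hC
  have h4 : C * τ ≤ C * (ε / (2 * (C + 1))) := mul_le_mul_of_nonneg_left hτε hC
  have h5 : C * (ε / (2 * (C + 1))) < ε := by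
    rw [mul_div_assoc']
    rw [div_lt_iff₀ (by positivity)]
    nlinarith
  linarith

/-- **The `θ → 0` extraction**: if `ρ θ² ≤ (1 − cos(θ/L)) k + sin²(θ/L) P + G θ⁴` for all
`θ ∈ (0, θ₁]` (`L > 0`, `G ≥ 0`), then `ρ L² ≤ k/2 + P` (expand `cos`, `sin` to second order).
[folklore] -/
theorem mul_sq_le_of_forall_flux {ρ k P G θ₁ L : ℝ} (hL : 0 < L) (hθ₁ : 0 < θ₁) (hG : 0 ≤ G)
    (h : ∀ θ : ℝ, 0 < θ → θ ≤ θ₁ →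
      ρ * θ ^ 2 ≤ (1 - Real.cos (θ / L)) * k + Real.sin (θ / L) ^ 2 * P + G * θ ^ 4) :
    ρ * L ^ 2 ≤ k / 2 + P := by
  by_contra hcon
  push Not at hcon
  have hε : 0 < ρ * L ^ 2 - (k / 2 + P) := sub_pos.2 hcon
  refine false_of_forall_le_mul_sq hε (C := 5 / 96 * |k| + |P| / 2 + G * L ^ 4) (by positivity)
    (lt_min (div_pos hθ₁ hL) one_pos) fun x hx0 hx1 => ?_
  have hxθ : x ≤ θ₁ / L := hx1.trans (min_le_left _ _)
  have hx1' : x ≤ 1 := hx1.trans (min_le_right _ _)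
  have hθ := h (L * x) (mul_pos hL hx0) (by rwa [← le_div_iff₀' hL])
  rw [mul_div_cancel_left₀ x hL.ne'] at hθ
  have hc := abs_one_sub_cos_sub_le hx0.le hx1'
  have hs := abs_sin_sq_sub_sq_le hx0.le hx1'
  have e1 : ((1 - Real.cos x) - x ^ 2 / 2) * k ≤ 5 / 96 * x ^ 4 * |k| :=
    calc ((1 - Real.cos x) - x ^ 2 / 2) * k ≤ |((1 - Real.cos x) - x ^ 2 / 2) * k| := le_abs_self _
      _ = |(1 - Real.cos x) - x ^ 2 / 2| * |k| := abs_mul _ _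
      _ ≤ 5 / 96 * x ^ 4 * |k| := mul_le_mul_of_nonneg_right hc (abs_nonneg k)
  have e2 : (Real.sin x ^ 2 - x ^ 2) * P ≤ x ^ 4 / 2 * |P| :=
    calc (Real.sin x ^ 2 - x ^ 2) * P ≤ |(Real.sin x ^ 2 - x ^ 2) * P| := le_abs_self _
      _ = |Real.sin x ^ 2 - x ^ 2| * |P| := abs_mul _ _
      _ ≤ x ^ 4 / 2 * |P| := mul_le_mul_of_nonneg_right hs (abs_nonneg P)
  have hx2 : 0 < x ^ 2 := by positivity
  have key : (ρ * L ^ 2 - (k / 2 + P)) * x ^ 2 ≤ (5 / 96 * |k| + |P| / 2 + G * L ^ 4) * x ^ 4 := by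
    nlinarith
  by_contra hlt
  push Not at hlt
  nlinarith

/-! ### The theorem -/

/-- **The current-moment stiffness ceiling for the `t–t'` class** (bounds.tex Thm 5; SHARPENING #6):
for `L ≥ 3`, every `t'`, `U`, `δ`, every `θ₀ > 0` and every real `ρ_s` with
`ρ_s θ² ≤ E^{tt'}_L(θ) − E^{tt'}_L(0)` for `|θ| ≤ θ₀`, every unit zero-flux `(N_L, 0)`-sector ground
state `ψ` of `hubbardTorusTT' L 1 t' U` and every `μ : ℝ` satisfy
`ρ_s L² ≤ (K_x + t' K_d)(ψ) − 2μ ‖Jψ‖² + μ² (Re⟨Jψ, H Jψ⟩ − E(0) ‖Jψ‖²)`, `J = curOpTT' L t'`.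
At `μ = ‖Jψ‖²/b` this is the f-sum ceiling minus `m₀(J)²/m₁(J)`. PROVED below
(`currentMomentStiffnessCeilingTT'_holds`). -/
@[conjecture] def CurrentMomentStiffnessCeilingTT' : Prop :=
  ∀ (L : ℕ) [NeZero L], 3 ≤ L → ∀ (t' U δ ρs θ₀ : ℝ), 0 < θ₀ →
    (∀ θ : ℝ, |θ| ≤ θ₀ → ρs * θ ^ 2 ≤ fluxEnergyTT' L t' U δ θ - fluxEnergyTT' L t' U δ 0) →
    ∀ ψ : Fock (Orb (FermionTorus 2 L)),
      IsGroundStateInSector (hubbardTorusTT' L 1 t' U) (2 * ⌊(1 - δ) * (L : ℝ) ^ 2 / 2⌋₊) 0 ψ →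
      star ψ ⬝ᵥ ψ = 1 → ∀ μ : ℝ,
      ρs * (L : ℝ) ^ 2 ≤
        ((∑ x : Site 2 L, ∑ σ : Fin 2,
            (star ψ ⬝ᵥ ((creation (orb (FermionTorus.ofTorusSite (Site.shift x 0)) σ) *
              annihilation (orb (FermionTorus.ofTorusSite x) σ)) *ᵥ ψ)).re) +
          t' * ∑ s : Fin 2, ∑ x : Site 2 L, ∑ σ : Fin 2,
            (star ψ ⬝ᵥ ((creation (orb (FermionTorus.ofTorusSite (x + torusDiagJump L s)) σ) *
              annihilation (orb (FermionTorus.ofTorusSite x) σ)) *ᵥ ψ)).re) -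
        2 * μ * (star (curOpTT' L t' *ᵥ ψ) ⬝ᵥ (curOpTT' L t' *ᵥ ψ)).re +
        μ ^ 2 * ((star (curOpTT' L t' *ᵥ ψ) ⬝ᵥ
            (hubbardTorusTT' L 1 t' U *ᵥ (curOpTT' L t' *ᵥ ψ))).re -
          fluxEnergyTT' L t' U δ 0 * (star (curOpTT' L t' *ᵥ ψ) ⬝ᵥ (curOpTT' L t' *ᵥ ψ)).re)

/-- **`CurrentMomentStiffnessCeilingTT'` holds.** Proof: the trial inequality at `(θ, m)` and at
`(−θ, −m)` with `m = −μ sin(θ/L)`, `E(−θ) = E(θ)`; the cross terms cancel, leaving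
`ρ_s θ² ≤ (1 − cos(θ/L)) Re⟨ψ,Kψ⟩ + sin²(θ/L)(μ² b − 2μ a) + O(θ⁴)`; then `θ → 0`. -/
theorem currentMomentStiffnessCeilingTT'_holds : CurrentMomentStiffnessCeilingTT' := by
  intro L _ hL t' U δ ρs θ₀ hθ₀ hstiff ψ hgs h1 μ
  have hL0 : (0 : ℝ) < L := Nat.cast_pos.2 (NeZero.pos L)
  have hLne : (L : ℝ) ≠ 0 := hL0.ne'
  have hK := re_star_dotProduct_kinOpTT'_mulVec t' ψ
  have ha0 : 0 ≤ (star (curOpTT' L t' *ᵥ ψ) ⬝ᵥ (curOpTT' L t' *ᵥ ψ)).re :=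
    (Complex.nonneg_iff.1 (dotProduct_star_self_nonneg _)).1
  have hT := fun θ m => fluxEnergyTT'_trial_le hL t' U δ θ m hgs h1
  generalize ha : (star (curOpTT' L t' *ᵥ ψ) ⬝ᵥ (curOpTT' L t' *ᵥ ψ)).re = a at hT ha0 ⊢
  generalize hj₁ : (star (curOpTT' L t' *ᵥ ψ) ⬝ᵥ ψ).re = j₁ at hT
  generalize hη : (star (curOpTT' L t' *ᵥ ψ) ⬝ᵥ
    (hubbardTorusTT' L 1 t' U *ᵥ (curOpTT' L t' *ᵥ ψ))).re = η at hT ⊢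
  generalize hk₁ : (star (curOpTT' L t' *ᵥ ψ) ⬝ᵥ (kinOpTT' L t' *ᵥ ψ)).re = k₁ at hT
  generalize hκ :
    (star (curOpTT' L t' *ᵥ ψ) ⬝ᵥ (kinOpTT' L t' *ᵥ (curOpTT' L t' *ᵥ ψ))).re = κ at hT
  generalize hjφ :
    (star (curOpTT' L t' *ᵥ ψ) ⬝ᵥ (curOpTT' L t' *ᵥ (curOpTT' L t' *ᵥ ψ))).re = jφ at hT
  generalize hj₀ : (star ψ ⬝ᵥ (curOpTT' L t' *ᵥ ψ)).re = j₀ at hT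
  generalize hk₀ : (star ψ ⬝ᵥ (kinOpTT' L t' *ᵥ ψ)).re = k₀ at hT hK
  generalize hE₀ : fluxEnergyTT' L t' U δ 0 = E₀ at hT hstiff ⊢
  have hmain : ρs * (L : ℝ) ^ 2 ≤ k₀ / 2 + (μ ^ 2 * (η - E₀ * a) - 2 * μ * a) := by
    refine mul_sq_le_of_forall_flux hL0 hθ₀
      (G := μ ^ 2 * (|κ| / (2 * (L : ℝ) ^ 4) + |ρs| * a / (L : ℝ) ^ 2)) (by positivity)
      fun θ hθ hθ₁ => ?_
    have hθabs : |θ| ≤ θ₀ := by rw [abs_of_pos hθ]; exact hθ₁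
    have hst := hstiff θ hθabs
    have hp := hT θ (-(μ * Real.sin (θ / L)))
    have hm := hT (-θ) (μ * Real.sin (θ / L))
    rw [neg_div, Real.cos_neg, Real.sin_neg, fluxEnergyTT'_neg] at hm
    have hc0 : 0 ≤ 1 - Real.cos (θ / L) := sub_nonneg.2 (Real.cos_le_one _)
    have hc2 : 1 - Real.cos (θ / L) ≤ (θ / L) ^ 2 / 2 := by
      linarith [Real.one_sub_sq_div_two_le_cos (x := θ / L)]
    have hs2 : Real.sin (θ / L) ^ 2 ≤ (θ / L) ^ 2 := Literature.Probability.LatticeModels.sin_sq_le_sq _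
    have hm0 : 0 ≤ 1 + (μ * Real.sin (θ / L)) ^ 2 * a := by positivity
    have hmul := mul_le_mul_of_nonneg_right hst hm0
    have hcomb : ρs * θ ^ 2 * (1 + (μ * Real.sin (θ / L)) ^ 2 * a) ≤
        (μ * Real.sin (θ / L)) ^ 2 * (η - E₀ * a) +
          (1 - Real.cos (θ / L)) * (k₀ + (μ * Real.sin (θ / L)) ^ 2 * κ) -
          2 * μ * Real.sin (θ / L) ^ 2 * a := by
      linarith
    have hY : (1 - Real.cos (θ / L)) * κ - ρs * θ ^ 2 * a ≤
        (θ / L) ^ 2 / 2 * |κ| + |ρs| * θ ^ 2 * a := by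
      have e1 : (1 - Real.cos (θ / L)) * κ ≤ (θ / L) ^ 2 / 2 * |κ| :=
        (mul_le_mul_of_nonneg_left (le_abs_self κ) hc0).trans
          (mul_le_mul_of_nonneg_right hc2 (abs_nonneg κ))
      have e2 : -(ρs * θ ^ 2 * a) ≤ |ρs| * θ ^ 2 * a :=
        calc -(ρs * θ ^ 2 * a) = (-ρs) * (θ ^ 2 * a) := by ring
          _ ≤ |ρs| * (θ ^ 2 * a) :=
              mul_le_mul_of_nonneg_right (neg_le_abs ρs) (mul_nonneg (sq_nonneg θ) ha0)
          _ = |ρs| * θ ^ 2 * a := by ring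
      linarith
    have hY0 : 0 ≤ (θ / L) ^ 2 / 2 * |κ| + |ρs| * θ ^ 2 * a := by positivity
    have hG : (μ * Real.sin (θ / L)) ^ 2 * ((1 - Real.cos (θ / L)) * κ - ρs * θ ^ 2 * a) ≤
        μ ^ 2 * (|κ| / (2 * (L : ℝ) ^ 4) + |ρs| * a / (L : ℝ) ^ 2) * θ ^ 4 :=
      calc (μ * Real.sin (θ / L)) ^ 2 * ((1 - Real.cos (θ / L)) * κ - ρs * θ ^ 2 * a)
          ≤ (μ * Real.sin (θ / L)) ^ 2 * ((θ / L) ^ 2 / 2 * |κ| + |ρs| * θ ^ 2 * a) :=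
            mul_le_mul_of_nonneg_left hY (sq_nonneg _)
        _ ≤ (μ ^ 2 * (θ / L) ^ 2) * ((θ / L) ^ 2 / 2 * |κ| + |ρs| * θ ^ 2 * a) := by
            refine mul_le_mul_of_nonneg_right ?_ hY0
            rw [mul_pow]
            exact mul_le_mul_of_nonneg_left hs2 (sq_nonneg μ)
        _ = μ ^ 2 * (|κ| / (2 * (L : ℝ) ^ 4) + |ρs| * a / (L : ℝ) ^ 2) * θ ^ 4 := by
            ring
    linarith
  rw [hK] at hmain
  linarith

/-! ### Corollaries -/

/-- **`m₁ ≥ 0`**: `E(0) ‖Jψ‖² ≤ Re⟨Jψ, H Jψ⟩` for every sector vector `ψ` (the current maps the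
sector into itself and `E(0)` is the sector minimum), i.e. the coefficient `b` of `μ²` in
`CurrentMomentStiffnessCeilingTT'` is non-negative. [cite: ScalapinoWhiteZhang1993, §II] -/
theorem fluxEnergyTT'_zero_mul_le_re_cur (t' U δ : ℝ) {ψ : Fock (Orb (FermionTorus 2 L))}
    (hψ : ψ ∈ szSector (2 * ⌊(1 - δ) * (L : ℝ) ^ 2 / 2⌋₊) 0) :
    fluxEnergyTT' L t' U δ 0 * (star (curOpTT' L t' *ᵥ ψ) ⬝ᵥ (curOpTT' L t' *ᵥ ψ)).re ≤
      (star (curOpTT' L t' *ᵥ ψ) ⬝ᵥ (hubbardTorusTT' L 1 t' U *ᵥ (curOpTT' L t' *ᵥ ψ))).re := by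
  rw [fluxEnergyTT'_eq, hubbardTorusTT'Flux_zero]
  exact minEnergyOn_mul_re_le (hubbardTorusTT'_isHermitian L 1 t' U) _
    (mulVec_mem_szSector_of_preservesSectors (preservesSectors_curOpTT' t') hψ)

/-- **The optimal `μ`** (`@[conjecture] def`, PROVED by `optimalCurrentMomentCeilingTT'_holds`;
bounds.tex Thm 5(ii)): with `a = ‖Jψ‖² = m₀`, `b = Re⟨Jψ, H Jψ⟩ − E(0)‖Jψ‖² = m₁`, every flux
stiffness of the `(N_L, 0)` sector and every unit zero-flux sector ground state `ψ` satisfy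
`0 ≤ b` AND `ρ_s L² ≤ (K_x + t' K_d)(ψ) − a²/b` — the f-sum ceiling minus the moment lower bound
`m₀²/m₁` on the paramagnetic current response (at `b = 0` Mathlib's `a²/0 = 0` returns the f-sum
ceiling, so no hypothesis on `b` is needed). -/
@[conjecture] def OptimalCurrentMomentCeilingTT' : Prop :=
  ∀ (L : ℕ) [NeZero L], 3 ≤ L → ∀ (t' U δ ρs θ₀ : ℝ), 0 < θ₀ →
    (∀ θ : ℝ, |θ| ≤ θ₀ → ρs * θ ^ 2 ≤ fluxEnergyTT' L t' U δ θ - fluxEnergyTT' L t' U δ 0) →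
    ∀ ψ : Fock (Orb (FermionTorus 2 L)),
      IsGroundStateInSector (hubbardTorusTT' L 1 t' U) (2 * ⌊(1 - δ) * (L : ℝ) ^ 2 / 2⌋₊) 0 ψ →
      star ψ ⬝ᵥ ψ = 1 →
      0 ≤ (star (curOpTT' L t' *ᵥ ψ) ⬝ᵥ
            (hubbardTorusTT' L 1 t' U *ᵥ (curOpTT' L t' *ᵥ ψ))).re -
          fluxEnergyTT' L t' U δ 0 * (star (curOpTT' L t' *ᵥ ψ) ⬝ᵥ (curOpTT' L t' *ᵥ ψ)).re ∧
      ρs * (L : ℝ) ^ 2 ≤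
        ((∑ x : Site 2 L, ∑ σ : Fin 2,
            (star ψ ⬝ᵥ ((creation (orb (FermionTorus.ofTorusSite (Site.shift x 0)) σ) *
              annihilation (orb (FermionTorus.ofTorusSite x) σ)) *ᵥ ψ)).re) +
          t' * ∑ s : Fin 2, ∑ x : Site 2 L, ∑ σ : Fin 2,
            (star ψ ⬝ᵥ ((creation (orb (FermionTorus.ofTorusSite (x + torusDiagJump L s)) σ) *
              annihilation (orb (FermionTorus.ofTorusSite x) σ)) *ᵥ ψ)).re) -
        (star (curOpTT' L t' *ᵥ ψ) ⬝ᵥ (curOpTT' L t' *ᵥ ψ)).re ^ 2 /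
          ((star (curOpTT' L t' *ᵥ ψ) ⬝ᵥ
              (hubbardTorusTT' L 1 t' U *ᵥ (curOpTT' L t' *ᵥ ψ))).re -
            fluxEnergyTT' L t' U δ 0 * (star (curOpTT' L t' *ᵥ ψ) ⬝ᵥ (curOpTT' L t' *ᵥ ψ)).re)

/-- **`OptimalCurrentMomentCeilingTT'` holds** (`μ = a/b` in `CurrentMomentStiffnessCeilingTT'`,
`b ≥ 0` by `fluxEnergyTT'_zero_mul_le_re_cur`). -/
theorem optimalCurrentMomentCeilingTT'_holds : OptimalCurrentMomentCeilingTT' := by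
  intro L _ hL t' U δ ρs θ₀ hθ₀ hstiff ψ hgs h1
  refine ⟨sub_nonneg.2 (fluxEnergyTT'_zero_mul_le_re_cur t' U δ hgs.1), ?_⟩
  have h := currentMomentStiffnessCeilingTT'_holds L hL t' U δ ρs θ₀ hθ₀ hstiff ψ hgs h1
  generalize (star (curOpTT' L t' *ᵥ ψ) ⬝ᵥ (curOpTT' L t' *ᵥ ψ)).re = a at h ⊢
  generalize (star (curOpTT' L t' *ᵥ ψ) ⬝ᵥ
    (hubbardTorusTT' L 1 t' U *ᵥ (curOpTT' L t' *ᵥ ψ))).re = η at h ⊢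
  generalize fluxEnergyTT' L t' U δ 0 = E₀ at h ⊢
  by_cases hb : η - E₀ * a = 0
  · have h0 := h 0
    rw [hb, div_zero]
    linarith
  · have hμ := h (a / (η - E₀ * a))
    have hid : -(2 * (a / (η - E₀ * a)) * a) + (a / (η - E₀ * a)) ^ 2 * (η - E₀ * a) =
        -(a ^ 2 / (η - E₀ * a)) := by
      field_simp
      ring
    linarith

/-- **`μ = 0`: the f-sum ceiling without a sign hypothesis on `ρ_s`** (`@[conjecture] def`, PROVED
by `kinWeightStiffnessCeilingTT'_holds`) — the Literature theorem
`stiffnessTT'_mul_sq_le_kinetic_of_isGroundStateInSector` (`ρ_s L² ≤ (K_x + t' K_d)(ψ)`, PTR98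
eq. (3) / HVR19 eqs. (2)–(4) for the `t–t'` class) minus its hypothesis `0 < ρ_s`. -/
@[conjecture] def KinWeightStiffnessCeilingTT' : Prop :=
  ∀ (L : ℕ) [NeZero L], 3 ≤ L → ∀ (t' U δ ρs θ₀ : ℝ), 0 < θ₀ →
    (∀ θ : ℝ, |θ| ≤ θ₀ → ρs * θ ^ 2 ≤ fluxEnergyTT' L t' U δ θ - fluxEnergyTT' L t' U δ 0) →
    ∀ ψ : Fock (Orb (FermionTorus 2 L)),
      IsGroundStateInSector (hubbardTorusTT' L 1 t' U) (2 * ⌊(1 - δ) * (L : ℝ) ^ 2 / 2⌋₊) 0 ψ →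
      star ψ ⬝ᵥ ψ = 1 →
      ρs * (L : ℝ) ^ 2 ≤
        (∑ x : Site 2 L, ∑ σ : Fin 2,
            (star ψ ⬝ᵥ ((creation (orb (FermionTorus.ofTorusSite (Site.shift x 0)) σ) *
              annihilation (orb (FermionTorus.ofTorusSite x) σ)) *ᵥ ψ)).re) +
          t' * ∑ s : Fin 2, ∑ x : Site 2 L, ∑ σ : Fin 2,
            (star ψ ⬝ᵥ ((creation (orb (FermionTorus.ofTorusSite (x + torusDiagJump L s)) σ) *
              annihilation (orb (FermionTorus.ofTorusSite x) σ)) *ᵥ ψ)).re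

/-- **`KinWeightStiffnessCeilingTT'` holds** (`μ = 0` in `CurrentMomentStiffnessCeilingTT'`). -/
theorem kinWeightStiffnessCeilingTT'_holds : KinWeightStiffnessCeilingTT' := by
  intro L _ hL t' U δ ρs θ₀ hθ₀ hstiff ψ hgs h1
  have h := currentMomentStiffnessCeilingTT'_holds L hL t' U δ ρs θ₀ hθ₀ hstiff ψ hgs h1 0
  simpa only [mul_zero, zero_mul, sub_zero, add_zero, zero_pow two_ne_zero,
    ne_eq] using h

end Summit.HubbardSuperconductivity.HubbardLadder.Bounds
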